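import Mathlib.Analysis.SpecialFunctions.Log.Deriv
import Mathlib.Analysis.SpecialFunctions.ExpDeriv
import Mathlib.MeasureTheory.Integral.IntervalIntegral.FundThmCalculus
import Literature.MathematicalPhysics.KineticTheory.HardSphereEulerProofs
import Literature.Analysis.FunctionSpaces.TorusSpaceTime
import HarnessLib

/-!
# The increment of the configurational log-partition function along a smooth activity family (stub
# `stub_logPartitionIncrement`, line `IdeatorTwoSketch`, crux `ClampedCurrentsDock`, stmt-AtomisticToContinuum-14680)

Helper file (`--supports stmt-AtomisticToContinuum-14680`) proving the registered stub
`stub_logPartitionIncrement : LogPartitionIncrement` (LPI, skeleton v19) of the lead's skeleton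
(`Cruxes/ClampedCurrentsDock/Lines/IdeatorTwoSketch.lean`): the static channel of Yau's relative-entropy ledger.
For `a : ℝ → 𝕋³ → ℝ` jointly smooth and positive on `[0,T) × 𝕋³`, the configurational partition function
`Z_pos(a_r) = ∫ 𝟙_{no overlap}(x) ∏ᵢ a_r(xᵢ) dx` of `n` hard spheres of diameter `ε` satisfies
`log Z_pos(a_{s₂}) − log Z_pos(a_{s₁}) = ∫_{s₁}^{s₂} Z_pos(a_r)⁻¹ ∫ posWeight(a_r)(x) Σᵢ ∂_r a_r(xᵢ)/a_r(xᵢ) dx dr`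
for `0 ≤ s₁ ≤ s₂ < T`.

Proof: the hard-core indicator does not depend on `r`, and `∏ᵢ a_r(xᵢ) = exp (Σᵢ log a_r(xᵢ))` (`a > 0`), so
`r ↦ posWeight(a_r)(x)` has one-sided derivative `posWeight(a_r)(x) Σᵢ ∂_r a_r(xᵢ)/a_r(xᵢ)` within `[0,T)`
(chain rule); `a`, `∂_r a` and `a⁻¹` are jointly smooth hence uniformly bounded on `K × 𝕋³` for compact
`K ⊆ [0,T)` (`Torus.IsSmoothSpaceTimeOn.exists_norm_le_of_isCompact`), so the tree's one-sided
differentiation-under-the-integral lemma `Torus.hasDerivWithinAt_integral_of_convex` (probability measure on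
`(𝕋³)ⁿ`) differentiates `Z_pos(a_r)` within `[0,T)`; `Real.log` by the chain rule (`Z_pos > 0`); the canonical mean is
continuous on `[s₁,s₂]` by dominated convergence (`MeasureTheory.continuousOn_of_dominated`); and the identity is the
fundamental theorem of calculus `intervalIntegral.integral_eq_sub_of_hasDerivAt_of_le` (interior times of `[s₁,s₂]` are
interior to `[0,T)`).
-/

noncomputable section

namespace Summit.AtomisticToContinuum.HydrodynamicLimit.Theorems.ClampedCurrentsDockLogPartition

open MeasureTheory Filter Set Topology
open scoped Interval
open Literature.MathematicalPhysics.KineticTheory Literature.Analysis.FluidPDE Literature.Analysis.FunctionSpaces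

/-- registered stub signature LPI of line IdeatorTwoSketch, crux ClampedCurrentsDock — route-internal, not a cited fact -/
def LogPartitionIncrement : Prop :=
  ∀ (ε T : ℝ) (n : ℕ) (a : ℝ → T3 → ℝ), Torus.IsSmoothSpaceTimeOn (Ico 0 T) a →
    (∀ t ∈ Ico 0 T, ∀ x, 0 < a t x) → (∀ t ∈ Ico 0 T, 0 < posPartition (a t) ε n) →
    ∀ s₁ s₂ : ℝ, 0 ≤ s₁ → s₁ ≤ s₂ → s₂ < T →
      ContinuousOn (fun r => Real.log (posPartition (a r) ε n)) (Icc s₁ s₂) ∧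
      IntervalIntegrable (fun r => (posPartition (a r) ε n)⁻¹ *
          ∫ x : Fin n → T3, posWeight (a r) ε n x *
            ∑ i, Torus.timeDerivWithin (Ico 0 T) a r (x i) / a r (x i)) volume s₁ s₂ ∧
      Real.log (posPartition (a s₂) ε n) - Real.log (posPartition (a s₁) ε n) =
        ∫ r in s₁..s₂, (posPartition (a r) ε n)⁻¹ *
          ∫ x : Fin n → T3, posWeight (a r) ε n x *
            ∑ i, Torus.timeDerivWithin (Ico 0 T) a r (x i) / a r (x i)

section LPI

variable {ε T : ℝ} {n : ℕ} {a : ℝ → T3 → ℝ}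

/-- Time slices of the activity are continuous on `𝕋³`. [folklore] -/
theorem continuous_slice (hu : Torus.IsSmoothSpaceTimeOn (Ico 0 T) a) {t : ℝ} (ht : t ∈ Ico 0 T) :
    Continuous (a t) :=
  (hu.isSmooth_slice ht).continuous

/-- Time slices of the one-sided time derivative of the activity are continuous on `𝕋³`. [folklore] -/
theorem continuous_timeDerivWithin_slice (hu : Torus.IsSmoothSpaceTimeOn (Ico 0 T) a) {t : ℝ}
    (ht : t ∈ Ico 0 T) : Continuous (Torus.timeDerivWithin (Ico 0 T) a t) :=
  (hu.isSmooth_timeDerivWithin (uniqueDiffOn_Ico 0 T) ht).continuous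

/-- The reciprocal of a positive jointly smooth activity is jointly smooth. [folklore] -/
theorem isSmoothSpaceTimeOn_inv (hu : Torus.IsSmoothSpaceTimeOn (Ico 0 T) a)
    (ha0 : ∀ t ∈ Ico 0 T, ∀ x, 0 < a t x) :
    Torus.IsSmoothSpaceTimeOn (Ico 0 T) (fun t x => (a t x)⁻¹) := by
  have h : Torus.stLift (fun t x => (a t x)⁻¹) = fun p => (Torus.stLift a p)⁻¹ := by
    funext p; rfl
  unfold Torus.IsSmoothSpaceTimeOn
  rw [h]
  exact ContDiffOn.inv hu fun p hp => (ha0 p.1 (mem_prod.1 hp).1 _).ne'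

/-- **Pointwise time derivative of the position weight.** The hard-core indicator does not depend on
time and `∏ᵢ a_τ(xᵢ) = exp (Σᵢ log a_τ(xᵢ))`, so within `[0,T)`
`d/dτ posWeight(a_τ)(x) = posWeight(a_τ)(x) Σᵢ ∂_τ a_τ(xᵢ)/a_τ(xᵢ)`. [folklore] -/
theorem hasDerivWithinAt_posWeight (hu : Torus.IsSmoothSpaceTimeOn (Ico 0 T) a)
    (ha0 : ∀ t ∈ Ico 0 T, ∀ x, 0 < a t x) {s : ℝ} (hs : s ∈ Ico 0 T) (x : Fin n → T3) :
    HasDerivWithinAt (fun τ => posWeight (a τ) ε n x)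
      (posWeight (a s) ε n x * ∑ i, Torus.timeDerivWithin (Ico 0 T) a s (x i) / a s (x i))
      (Ico 0 T) s := by
  -- logarithmic differentiation of the product
  have hsum : HasDerivWithinAt (fun τ => ∑ i, Real.log (a τ (x i)))
      (∑ i, Torus.timeDerivWithin (Ico 0 T) a s (x i) / a s (x i)) (Ico 0 T) s :=
    HasDerivWithinAt.fun_sum fun i _ => (hu.hasDerivWithinAt_slice hs (x i)).log (ha0 s hs (x i)).ne'
  have hexp := hsum.exp
  have heq : ∀ τ ∈ Ico 0 T, Real.exp (∑ i, Real.log (a τ (x i))) = ∏ i, a τ (x i) := by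
    intro τ hτ
    rw [Real.exp_sum]
    exact Finset.prod_congr rfl fun i _ => Real.exp_log (ha0 τ hτ (x i))
  have hprod : HasDerivWithinAt (fun τ => ∏ i, a τ (x i))
      ((∏ i, a s (x i)) * ∑ i, Torus.timeDerivWithin (Ico 0 T) a s (x i) / a s (x i))
      (Ico 0 T) s := by
    rw [← heq s hs]
    exact hexp.congr_of_mem (fun τ hτ => (heq τ hτ).symm) hs
  by_cases hx : x ∈ posDomain ε n
  · simp only [posWeight, Set.indicator_of_mem hx]
    exact hprod
  · simp only [posWeight, Set.indicator_of_notMem hx, zero_mul]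
    exact hasDerivWithinAt_const s (Ico 0 T) (0 : ℝ)

/-- **Uniform bound on compact time sets.** On `K × (𝕋³)ⁿ`, `K ⊆ [0,T)` compact, the derivative
integrand `posWeight(a_s)(x) Σᵢ ∂_s a_s(xᵢ)/a_s(xᵢ)` is bounded (`a`, `∂_s a`, `a⁻¹` are bounded there). [folklore] -/
theorem exists_bound_dWeight (hu : Torus.IsSmoothSpaceTimeOn (Ico 0 T) a)
    (ha0 : ∀ t ∈ Ico 0 T, ∀ x, 0 < a t x) {K : Set ℝ} (hK : IsCompact K) (hKS : K ⊆ Ico 0 T) :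
    ∃ C : ℝ, ∀ s ∈ K, ∀ x : Fin n → T3,
      ‖posWeight (a s) ε n x * ∑ i, Torus.timeDerivWithin (Ico 0 T) a s (x i) / a s (x i)‖ ≤ C := by
  obtain ⟨A, hA⟩ := hu.exists_norm_le_of_isCompact hK hKS
  obtain ⟨B, hB⟩ := (hu.timeDerivWithin (uniqueDiffOn_Ico 0 T)).exists_norm_le_of_isCompact hK hKS
  obtain ⟨C, hC⟩ := (isSmoothSpaceTimeOn_inv hu ha0).exists_norm_le_of_isCompact hK hKS
  refine ⟨A ^ n * (n * (B * C)), fun s hs x => ?_⟩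
  have hsS : s ∈ Ico 0 T := hKS hs
  have hA0 : 0 ≤ A := (norm_nonneg _).trans (hA s hs 0)
  have hB0 : 0 ≤ B := (norm_nonneg _).trans (hB s hs 0)
  have ha0' : ∀ y, 0 ≤ a s y := fun y => (ha0 s hsS y).le
  have hAle : ∀ y, a s y ≤ A := fun y => (le_abs_self _).trans ((Real.norm_eq_abs _).symm.le.trans (hA s hs y))
  rw [norm_mul, Real.norm_eq_abs, Real.norm_eq_abs, abs_of_nonneg (posWeight_nonneg ha0' ε x)]
  refine mul_le_mul (posWeight_le_pow ha0' hAle ε x) ?_ (abs_nonneg _) (pow_nonneg hA0 n)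
  calc |∑ i, Torus.timeDerivWithin (Ico 0 T) a s (x i) / a s (x i)|
      ≤ ∑ i, |Torus.timeDerivWithin (Ico 0 T) a s (x i) / a s (x i)| := Finset.abs_sum_le_sum_abs _ _
    _ ≤ ∑ _i : Fin n, B * C := Finset.sum_le_sum fun i _ => by
        rw [div_eq_mul_inv, abs_mul]
        exact mul_le_mul ((Real.norm_eq_abs _).symm.le.trans (hB s hs (x i)))
          ((Real.norm_eq_abs _).symm.le.trans (hC s hs (x i))) (abs_nonneg _) hB0
    _ = n * (B * C) := by simp

/-- The derivative integrand is measurable in the configuration at every time of `[0,T)`. [folklore] -/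
theorem aestronglyMeasurable_dWeight (hu : Torus.IsSmoothSpaceTimeOn (Ico 0 T) a)
    (ha0 : ∀ t ∈ Ico 0 T, ∀ x, 0 < a t x) {t : ℝ} (ht : t ∈ Ico 0 T) :
    AEStronglyMeasurable (fun x : Fin n → T3 =>
      posWeight (a t) ε n x * ∑ i, Torus.timeDerivWithin (Ico 0 T) a t (x i) / a t (x i)) volume := by
  have hc : Continuous fun x : Fin n → T3 =>
      ∑ i, Torus.timeDerivWithin (Ico 0 T) a t (x i) / a t (x i) :=
    continuous_finsetSum _ fun i _ =>
      ((continuous_timeDerivWithin_slice hu ht).comp (continuous_apply i)).div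
        ((continuous_slice hu ht).comp (continuous_apply i)) fun x => (ha0 t ht (x i)).ne'
  exact ((measurable_posWeight (continuous_slice hu ht) ε n).mul hc.measurable).aestronglyMeasurable

/-- **Differentiation of `Z_pos(a_r)` under the integral sign** within `[0,T)`:
`d/dr Z_pos(a_r) = ∫ posWeight(a_r)(x) Σᵢ ∂_r a_r(xᵢ)/a_r(xᵢ) dx` (one-sided at `r = 0`). [folklore] -/
theorem hasDerivWithinAt_posPartition (hu : Torus.IsSmoothSpaceTimeOn (Ico 0 T) a)
    (ha0 : ∀ t ∈ Ico 0 T, ∀ x, 0 < a t x) {t : ℝ} (ht : t ∈ Ico 0 T) :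
    HasDerivWithinAt (fun r => posPartition (a r) ε n)
      (∫ x : Fin n → T3, posWeight (a t) ε n x *
        ∑ i, Torus.timeDerivWithin (Ico 0 T) a t (x i) / a t (x i)) (Ico 0 T) t := by
  -- a compact time set `K ⊆ [0,T)` containing a neighbourhood of `t` within `[0,T)`
  set T' : ℝ := (t + T) / 2 with hT'
  have htT' : t < T' := by rw [hT']; linarith [ht.2]
  have hT'T : T' < T := by rw [hT']; linarith [ht.2]
  have hKS : Icc 0 T' ⊆ Ico 0 T := fun s hs => ⟨hs.1, hs.2.trans_lt hT'T⟩
  obtain ⟨C, hC⟩ := exists_bound_dWeight (ε := ε) (n := n) hu ha0 isCompact_Icc hKS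
  have hev : ∀ᶠ s in 𝓝[Ico 0 T] t, s ∈ Icc 0 T' := by
    have h1 : ∀ᶠ s in 𝓝[Ico 0 T] t, s ∈ Ico 0 T := self_mem_nhdsWithin
    have h2 : ∀ᶠ s in 𝓝[Ico 0 T] t, s ∈ Iio T' := mem_nhdsWithin_of_mem_nhds (Iio_mem_nhds htT')
    filter_upwards [h1, h2] with s hs hs2 using ⟨hs.1, le_of_lt hs2⟩
  unfold posPartition
  exact Torus.hasDerivWithinAt_integral_of_convex (μ := volume) (convex_Ico 0 T) ht
    (F := fun s x => posWeight (a s) ε n x)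
    (F' := fun s x => posWeight (a s) ε n x *
      ∑ i, Torus.timeDerivWithin (Ico 0 T) a s (x i) / a s (x i))
    (fun s hs => integrable_posWeight (continuous_slice hu hs) (fun y => (ha0 s hs y).le) ε n)
    (fun s hs x => hasDerivWithinAt_posWeight hu ha0 hs x)
    (by filter_upwards [hev] with s hs using hC s hs)
    (aestronglyMeasurable_dWeight hu ha0 ht)

/-- The derivative integrand is continuous in time within `[0,T)` at every configuration. [folklore] -/
theorem continuousOn_dWeight (hu : Torus.IsSmoothSpaceTimeOn (Ico 0 T) a)
    (ha0 : ∀ t ∈ Ico 0 T, ∀ x, 0 < a t x) (x : Fin n → T3) :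
    ContinuousOn (fun r => posWeight (a r) ε n x *
      ∑ i, Torus.timeDerivWithin (Ico 0 T) a r (x i) / a r (x i)) (Ico 0 T) := by
  intro r hr
  refine (hasDerivWithinAt_posWeight hu ha0 hr x).continuousWithinAt.mul ?_
  have h : ContinuousOn (fun r => ∑ i, Torus.timeDerivWithin (Ico 0 T) a r (x i) / a r (x i))
      (Ico 0 T) :=
    continuousOn_finsetSum _ fun i _ => ContinuousOn.div
      (fun r hr => ((hu.timeDerivWithin (uniqueDiffOn_Ico 0 T)).hasDerivWithinAt_slice hr
        (x i)).continuousWithinAt)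
      (fun r hr => (hu.hasDerivWithinAt_slice hr (x i)).continuousWithinAt)
      fun r hr => (ha0 r hr (x i)).ne'
  exact h r hr

/-- **Continuity of the canonical mean.** `r ↦ ∫ posWeight(a_r)(x) Σᵢ ∂_r a_r(xᵢ)/a_r(xᵢ) dx` is
continuous on every compact `K ⊆ [0,T)` (dominated convergence with a constant bound on the probability
space `(𝕋³)ⁿ`). [folklore] -/
theorem continuousOn_integral_dWeight (hu : Torus.IsSmoothSpaceTimeOn (Ico 0 T) a)
    (ha0 : ∀ t ∈ Ico 0 T, ∀ x, 0 < a t x) {K : Set ℝ} (hK : IsCompact K) (hKS : K ⊆ Ico 0 T) :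
    ContinuousOn (fun r => ∫ x : Fin n → T3, posWeight (a r) ε n x *
      ∑ i, Torus.timeDerivWithin (Ico 0 T) a r (x i) / a r (x i)) K := by
  obtain ⟨C, hC⟩ := exists_bound_dWeight (ε := ε) (n := n) hu ha0 hK hKS
  exact continuousOn_of_dominated (bound := fun _ => C)
    (fun r hr => aestronglyMeasurable_dWeight hu ha0 (hKS hr))
    (fun r hr => Eventually.of_forall (hC r hr)) (integrable_const C)
    (Eventually.of_forall fun x => (continuousOn_dWeight hu ha0 x).mono hKS)

end LPI

/-- **STUB LPI `stub_logPartitionIncrement`** of line `IdeatorTwoSketch` (crux `ClampedCurrentsDock`,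
stmt-14680): the increment of `log Z_pos(a_r)` over `[s₁, s₂] ⊆ [0,T)` is the time integral of the canonical
mean of `Σᵢ ∂_r log a_r(xᵢ)`. [folklore] -/
theorem stub_logPartitionIncrement : LogPartitionIncrement := by
  intro ε T n a hu ha0 hZ s₁ s₂ hs₁ h12 hs₂T
  have hsub : Icc s₁ s₂ ⊆ Ico 0 T := fun r hr => ⟨hs₁.trans hr.1, hr.2.trans_lt hs₂T⟩
  -- the chain rule for `log Z_pos(a_r)` within `[0,T)`
  have hlog : ∀ r ∈ Ico 0 T, HasDerivWithinAt (fun r => Real.log (posPartition (a r) ε n))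
      ((posPartition (a r) ε n)⁻¹ * ∫ x : Fin n → T3, posWeight (a r) ε n x *
        ∑ i, Torus.timeDerivWithin (Ico 0 T) a r (x i) / a r (x i)) (Ico 0 T) r := by
    intro r hr
    have h := (hasDerivWithinAt_posPartition (ε := ε) (n := n) hu ha0 hr).log (hZ r hr).ne'
    rw [div_eq_inv_mul] at h
    exact h
  have hcont : ContinuousOn (fun r => Real.log (posPartition (a r) ε n)) (Icc s₁ s₂) :=
    fun r hr => ((hlog r (hsub hr)).continuousWithinAt).mono hsub
  have hZcont : ContinuousOn (fun r => posPartition (a r) ε n) (Icc s₁ s₂) :=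
    fun r hr => ((hasDerivWithinAt_posPartition (ε := ε) (n := n) hu ha0
      (hsub hr)).continuousWithinAt).mono hsub
  have hint : IntervalIntegrable (fun r => (posPartition (a r) ε n)⁻¹ *
      ∫ x : Fin n → T3, posWeight (a r) ε n x *
        ∑ i, Torus.timeDerivWithin (Ico 0 T) a r (x i) / a r (x i)) volume s₁ s₂ :=
    ((hZcont.inv₀ fun r hr => (hZ r (hsub hr)).ne').mul
      (continuousOn_integral_dWeight hu ha0 isCompact_Icc hsub)).intervalIntegrable_of_Icc h12
  refine ⟨hcont, hint, ?_⟩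
  exact (intervalIntegral.integral_eq_sub_of_hasDerivAt_of_le h12 hcont
    (fun r hr => (hlog r ⟨hs₁.trans hr.1.le, hr.2.trans hs₂T⟩).hasDerivAt
      (Ico_mem_nhds (hs₁.trans_lt hr.1) (hr.2.trans hs₂T)))
    hint).symm

end Summit.AtomisticToContinuum.HydrodynamicLimit.Theorems.ClampedCurrentsDockLogPartition
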